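import Literature.AlgebraicGeometry.Resolution.KnafKuhlmann2009Thm11Parts
import Mathlib.FieldTheory.IsSepClosed
import HarnessLib

/-!
# Knaf–Kuhlmann 2009, Thm. 3.8 + Lemma 3.7: henselian rationality as uniformizability over `O_{K(x)}`

Topic: `Literature/AlgebraicGeometry/Resolution`. The deep input of Knaf–Kuhlmann 2009, Prop. 3.10
(the named fact `KnafKuhlmann2009_Prop310_sepClosed` of `KnafKuhlmann2009Thm11Parts.lean`, one of
the two named facts on which the fact `KnafKuhlmann2009` = KK09 Thm. 1.2 now rests,
`KnafKuhlmann2009Frontier.lean`) is F.-V. Kuhlmann's HENSELIAN RATIONALITY of immediate function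
fields (KK09 Thm. 3.8 = [K8]), entering the printed proof of Prop. 3.10 (p. 14 of the arXiv PDF)
only in combination with the étale-local structure Lemma 3.7 (2), (3) ([Ray] X Thm. 1):

> "By Theorem 3.8 there exists some `x ∈ F` such that `(F,P) ⊂ (K(x)^h, P^h)`. Since `(K,P)` is
> separably tame and hence separable-algebraically maximal, Lemma 2.16 shows that condition (3)
> holds in `(K(x)|K,P)`. Therefore `P|_{K(x)}` is strongly smoothly `O_K`-uniformizable by
> Lemma 3.9. Lemma 3.7, (2) and (3) yield that `P` is strongly smoothly `O_{K(x)}`-uniformizable.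
> The assertion now follows from Corollary 3.6."

This file vendors that combination as ONE named fact, so that neither the henselization `K(x)^h`
nor the absolute inertia field has to be rendered (Mathlib has no henselization of valued
fields); Lemma 2.16 (for separably closed `K`: `KnafKuhlmann2009Lemma216.lean`), Lemma 3.9
(`ImmediateRationalUniformization.lean`) and the stacking Cor. 3.6 (Prop. 3.2 in the strong form
`knafKuhlmann2009_prop32_adjoin`) are theorems of the topic, and Prop. 3.10 is assembled from
this fact in `KnafKuhlmann2009Prop310.lean`.

* `KnafKuhlmann2009_Thm38_Lemma37_sepClosed` — NAMED FACT: for `K` separably closed (a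
  separably tame valued field for every valuation: it is henselian, its algebraic extensions being
  purely inseparable, and `K^{sep} = K` is its own absolute ramification field — the case
  `(K^{sep}, 𝓟)` of §4.1), and `(F|K, P)` an immediate valued function field of transcendence
  degree `1` with `F|K` separable: there is `x ∈ F`, a transcendence basis of `F|K`, such that
  `P` is strongly smoothly `O_{K(x)}`-uniformizable. This is Thm. 3.8 ("there exists `x ∈ F` such
  that `(F,P)` lies in the henselization `(K(x)^h, P^h)`, that is `(F|K,P)` is henselian
  generated" — henselian generated := "admits a transcendence basis `T` such that `(F,P)` lies in
  the henselization of `(K(T),P|_{K(T)})`", §1 p. 5) followed by Lemma 3.7 (3) ⇐ and (2) ⇐ for the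
  finite extension `F|K(x)` ("`O_P|O_L` is local-étale if and only if `(F,P)` lies in the
  absolute inertia field of `(L,P)`", which contains the henselization; "`P` is strongly smoothly
  `O_L`-uniformizable if and only if `O_P|O_L` is local-étale").

* `KnafKuhlmann2009_Thm38_sepClosed` — NAMED FACT, the valuation-theoretic kernel of the
  previous fact: Thm. 3.8 alone (for `K` separably closed), its conclusion "`(F,P)` lies in
  the henselization `(K(x)^h, P^h)`" rendered for the finite extension `F|K(x)` in the
  standard-étale / Hensel-root form furnished by Lemma 3.7 (3) ([Ray] X Thm. 1, V Thm. 1):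
  `F = K(x)(η)` with `η ∈ O_F` a root of a monic `f` over `O_{K(x)}` such that `f'(η)` is a
  unit of `O_P` (conversely such an `η` lies in `K(x)^h` by Hensel's Lemma). From this fact
  the previous one FOLLOWS by the proved Lemma 3.7 (2) ⇐
  (`isSmoothlyUniformizableIn_of_henselRoot`, `LocalEtaleUniformization.lean`); the
  assembly `KnafKuhlmann2009_Thm38_Lemma37_sepClosed.of_thm38` is in
  `KnafKuhlmann2009HenselianRationalityProofs.lean`.

## Sources

* [KK09] H. Knaf, F.-V. Kuhlmann, *Every place admits local uniformization in a finite extension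
  of the function field*, Adv. Math. 221 (2009) 428–453 = arXiv:math/0702856: §1 (p. 5:
  inertially / henselian generated), Lemma 3.7 and Thm. 3.8 (p. 13), proof of Prop. 3.10 (p. 14).
  Pages of the 19-page arXiv PDF.
* [K8] F.-V. Kuhlmann, *Elimination of ramification II: Henselian rationality*, Israel J. Math.
  234 (2019) 927–958 ([KK09]'s "[K8], in preparation"; the proof of Thm. 3.8).
* [Ray] M. Raynaud, *Anneaux locaux henséliens*, LNM 169 (1970), Ch. X Thm. 1 (Lemma 3.7 (3)).

## Rendering notes

Ambient rendering of `ValuedFunctionFields.lean` / `KnafKuhlmann2009Thm11Parts.lean` (same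
hypotheses, in the same form, as `KnafKuhlmann2009_Prop310_sepClosed`): `K ≤ F ≤ Ω` subfields of a
valued field `(Ω, V)`, `O_M = V ∩ M`; "valued function field of transcendence degree `1`" =
`F|K` finitely generated with some `x ∈ F` transcendental over `K` and `F` algebraic over `K(x)`;
"`F|K` separable" = separably generated; immediate = `IsImmediateOver`; "`x` a transcendence
basis" = `Transcendental K x` (algebraicity of `F` over `K(x)` is then automatic and not
restated); `K(x) = Subfield.closure (K ∪ {x})`; "`P` strongly smoothly `O_{K(x)}`-uniformizable" =
every finite `Z ⊆ O_P = V ∩ F` gives `IsSmoothlyUniformizableIn O_{K(x)} V F Z` with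
`O_{K(x)} = V.toSubring ⊓ (K(x)).toSubring`; "`η` a Hensel root over `O_{K(x)}`" = a monic
polynomial `f` over `Ω` with coefficients in `V ∩ K(x)`, `f(η) = 0`, `V.valuation (f'(η)) = 1`
(values written multiplicatively). Nothing is proved in this file beyond unfolding lemmas.
-/

noncomputable section

namespace Literature.AlgebraicGeometry.Resolution

universe u

/-- NAMED FACT — **Knaf–Kuhlmann 2009, Thm. 3.8 combined with Lemma 3.7 (2), (3), over a
separably closed ground field** (Thm. 3.8: "Let `(F|K,P)` be an immediate, valued function field
of transcendence degree 1 and assume that `(K,P)` is separably tame. If `F|K` is separable, then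
there exists `x ∈ F` such that `(F,P)` lies in the henselization `(K(x)^h,P^h)`, that is
`(F|K,P)` is henselian generated."; Lemma 3.7: "Let `(F|L,P)` be a finite valued field extension
[…] 2. `P` is strongly smoothly `O_L`-uniformizable if and only if `O_P|O_L` is local-étale.
3. `O_P|O_L` is local-étale if and only if `(F,P)` lies in the absolute inertia field of
`(L,P)`."; applied with `L = K(x)`, as in the proof of Prop. 3.10, p. 14: "Lemma 3.7, (2) and (3)
yield that `P` is strongly smoothly `O_{K(x)}`-uniformizable"). Vendored for `K` separably closed
(separably tame for every valuation) in the rendering of the module docstring: there is a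
transcendence basis `{x} ⊆ F` of `F|K` such that every finite `Z ⊆ V ∩ F` is smoothly
`O_{K(x)}`-uniformizable. The proof of Thm. 3.8 is [K8] (henselian rationality); of Lemma 3.7 (3),
[Ray] X Thm. 1. Users take `(h : KnafKuhlmann2009_Thm38_Lemma37_sepClosed)`.
[cite: KnafKuhlmann2009, Thm. 3.8 and Lemma 3.7] -/
def KnafKuhlmann2009_Thm38_Lemma37_sepClosed : Prop :=
  ∀ (Ω : Type u) [Field Ω] (V : ValuationSubring Ω) (K F : Subfield Ω), IsSepClosed K →
    K ≤ F → FGOver K F → SeparablyGeneratedOver K F →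
    (∃ x ∈ F, Transcendental K x ∧
      ∀ z ∈ F, IsAlgebraic (IntermediateField.adjoin K ({x} : Set Ω)) z) →
    IsImmediateOver V K F →
    ∃ x ∈ F, Transcendental K x ∧
      ∀ Z : Finset Ω, (∀ z ∈ Z, z ∈ V ∧ z ∈ F) →
        IsSmoothlyUniformizableIn
          ↥(V.toSubring ⊓ (Subfield.closure ((K : Set Ω) ∪ {x})).toSubring) V F (Z : Set Ω)

/-- NAMED FACT — **Knaf–Kuhlmann 2009, Thm. 3.8 (F.-V. Kuhlmann's henselian rationality)
over a separably closed ground field, in Hensel-root form.** Thm. 3.8: "Let `(F|K,P)` be an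
immediate, valued function field of transcendence degree 1 and assume that `(K,P)` is
separably tame. If `F|K` is separable, then there exists `x ∈ F` such that `(F,P)` lies in
the henselization `(K(x)^h,P^h)`, that is `(F|K,P)` is henselian generated." (p. 13; proof in
[K8]; for `char KP = 0` "every `x ∈ F ∖ K` will then do the job"). Vendored for `K`
separably closed (separably tame for every valuation), with the hypotheses of
`KnafKuhlmann2009_Prop310_sepClosed`, and with the conclusion rendered — Mathlib having no
henselization — for the finite extension `F|K(x)` in the standard-étale form in which the
proof of Prop. 3.10 (p. 14) consumes it through Lemma 3.7 (3) ("`O_P|O_L` is local-étale if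
and only if `(F,P)` lies in the absolute inertia field of `(L,P)`", [Ray] X Thm. 1; a
local-étale `O_P|O_{K(x)}` is `A_q` for a standard-étale `A = O_{K(x)}[X]_g/(f)`, `f` monic,
`φ(f')` a unit, [Ray] V Thm. 1 and §3.1 p. 11): there are `x ∈ F` transcendental over `K`
and `η ∈ O_P` with `F = K(x)(η)`, `η` a root of a monic polynomial `f` over `O_{K(x)}` whose
derivative `f'(η)` is a unit of `O_P`. (Conversely such an `η` lies in `K(x)^h` by Hensel's
Lemma, so this is the printed conclusion.) This is the deep input of
`KnafKuhlmann2009_Thm38_Lemma37_sepClosed`, which follows from it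
(`KnafKuhlmann2009_Thm38_Lemma37_sepClosed.of_thm38`,
`KnafKuhlmann2009HenselianRationalityProofs.lean`). Users take
`(h : KnafKuhlmann2009_Thm38_sepClosed)`.
[cite: KnafKuhlmann2009, Thm. 3.8 and Lemma 3.7 (3)] -/
def KnafKuhlmann2009_Thm38_sepClosed : Prop :=
  ∀ (Ω : Type u) [Field Ω] (V : ValuationSubring Ω) (K F : Subfield Ω), IsSepClosed K →
    K ≤ F → FGOver K F → SeparablyGeneratedOver K F →
    (∃ x ∈ F, Transcendental K x ∧
      ∀ z ∈ F, IsAlgebraic (IntermediateField.adjoin K ({x} : Set Ω)) z) →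
    IsImmediateOver V K F →
    ∃ x ∈ F, Transcendental K x ∧ ∃ η ∈ V, ∃ f : Polynomial Ω,
      Subfield.closure ((Subfield.closure ((K : Set Ω) ∪ {x}) : Set Ω) ∪ {η}) = F ∧
      f.Monic ∧ (∀ k, f.coeff k ∈ V ∧ f.coeff k ∈ Subfield.closure ((K : Set Ω) ∪ {x})) ∧
      f.eval η = 0 ∧ V.valuation ((Polynomial.derivative f).eval η) = 1

/-! ## API -/

/-- The fact with `Z = ∅`: an `O_{K(x)}`-model of `F` smooth at the centre, for a transcendence
basis `{x}`. [folklore] -/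
theorem KnafKuhlmann2009_Thm38_Lemma37_sepClosed.exists_model
    (h : KnafKuhlmann2009_Thm38_Lemma37_sepClosed.{u}) (Ω : Type u) [Field Ω]
    (V : ValuationSubring Ω) (K F : Subfield Ω) [IsSepClosed K] (hKF : K ≤ F) (hfg : FGOver K F)
    (hsep : SeparablyGeneratedOver K F)
    (h1 : ∃ x ∈ F, Transcendental K x ∧
      ∀ z ∈ F, IsAlgebraic (IntermediateField.adjoin K ({x} : Set Ω)) z)
    (himm : IsImmediateOver V K F) :
    ∃ x ∈ F, Transcendental K x ∧ IsSmoothlyUniformizableIn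
      ↥(V.toSubring ⊓ (Subfield.closure ((K : Set Ω) ∪ {x})).toSubring) V F ∅ := by
  obtain ⟨x, hxF, hx, hZ⟩ := h Ω V K F ‹_› hKF hfg hsep h1 himm
  exact ⟨x, hxF, hx, by simpa using hZ ∅ (by simp)⟩

/-- The data of `KnafKuhlmann2009_Thm38_sepClosed` unfolded: `x, η ∈ F`, `K(x) ≤ F`, and the
Hensel root equation. [folklore] -/
theorem KnafKuhlmann2009_Thm38_sepClosed.exists_henselRoot
    (h : KnafKuhlmann2009_Thm38_sepClosed.{u}) (Ω : Type u) [Field Ω]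
    (V : ValuationSubring Ω) (K F : Subfield Ω) [IsSepClosed K] (hKF : K ≤ F) (hfg : FGOver K F)
    (hsep : SeparablyGeneratedOver K F)
    (h1 : ∃ x ∈ F, Transcendental K x ∧
      ∀ z ∈ F, IsAlgebraic (IntermediateField.adjoin K ({x} : Set Ω)) z)
    (himm : IsImmediateOver V K F) :
    ∃ x ∈ F, ∃ η ∈ F, Transcendental K x ∧ η ∈ V ∧
      Subfield.closure ((K : Set Ω) ∪ {x}) ≤ F ∧
      ∃ f : Polynomial Ω, f.Monic ∧
        (∀ k, f.coeff k ∈ V ∧ f.coeff k ∈ Subfield.closure ((K : Set Ω) ∪ {x})) ∧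
        f.eval η = 0 ∧ V.valuation ((Polynomial.derivative f).eval η) = 1 := by
  obtain ⟨x, hxF, hx, η, hηV, f, hgen, hmon, hcoeff, hfη, hder⟩ :=
    h Ω V K F ‹_› hKF hfg hsep h1 himm
  refine ⟨x, hxF, η, hgen ▸ Subfield.subset_closure (Or.inr rfl), hx, hηV,
    fun c hc => hgen ▸ Subfield.subset_closure (Or.inl hc), f, hmon, hcoeff, hfη, hder⟩

end Literature.AlgebraicGeometry.Resolution

end
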